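import Summits.QuantumFields.YangMills.Theses.LangevinControlUV
import Literature.MathematicalPhysics.QuantumFieldTheory.MassGapFromDiagonalClustering

/-!
# Crux `GapToContinuum` (stmt-QuantumFields-8896), line `SketchIdeator4`: stub `stub_diagBoundToGap` (L1)

Registered stub L1 of the skeleton `Lines/SketchIdeator4.lean` (route `LangevinControlUV`, sub-problem
`YangMills`): the CONTINUUM-SIDE diagonal self-improvement lemma.  For Osterwalder–Schrader data `T`
on `ℝ^d`, `d ≥ 2`, a diagonal exponential bound with a FREE constant per single slab-ordered real
product tensor `P` (every arity `n ≥ 1`, every label string `k`),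
`‖𝔖₂ₙ^{rev k ++ k}(ΘP* ⊗ T_t P) − 𝔖ₙ^{rev k}(ΘP*) 𝔖ₙ^{k}(P)‖ ≤ C(P) e^{−Δt}` (`t ≥ 0`), already
gives the full-spectrum mass gap `T.HasMassGap Δ`.  It is the Literature theorem
`OSData.hasMassGap_of_diagBound` (`MassGapFromDiagonalClustering.lean`: E2 log-convexity of
`t ↦ ⟨v, e^{−tH}v⟩` with infinite horizon in the OS Hilbert space, positivity on spans,
Cauchy–Schwarz, `OSData.hasMassGap_of_csBound_span`), restated verbatim in the registered signature.

With this stub the crux `GapToContinuum` is reduced EXACTLY to its minimal core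
`stub_diagBound_of_latticeGap` (`IsYangMillsFor → HasLatticeMassGap → diagonal bound`), which is
equivalent to the typed crux (the diagonal bound is trivially necessary for `T.HasMassGap Δ`).
-/

namespace Summit.QuantumFields.YangMills.Theorems.GapToContinuum.SketchIdeator4

open scoped SchwartzMap
open Literature.MathematicalPhysics.AQFT Literature.MathematicalPhysics.QuantumLattice
open Literature.MathematicalPhysics.QuantumFieldTheory

/-- **Stub L1 (continuum-side diagonal self-improvement)** of line `SketchIdeator4` for crux
`GapToContinuum`: diagonal exponential bounds with free constants on the slab-ordered real product
tensors give the full-spectrum mass gap of OS data (`d ≥ 2`) — the Literature theorem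
`OSData.hasMassGap_of_diagBound`. -/
theorem stub_diagBoundToGap :
    ∀ (ι : Type) (d : ℕ) [NeZero d], 1 < d → ∀ (T : OSData ι d) (Δ : ℝ),
      (∀ (n : ℕ), n ≠ 0 → ∀ (k : Fin n → ι) (P : 𝓢((Fin n → EuclideanSpace ℝ (Fin d)), ℂ)),
        P ∈ slabOrderedProducts d n → ∃ C : ℝ, ∀ t : ℝ, 0 ≤ t →
          ‖T.schwinger (n + n) (Fin.append (k ∘ Fin.rev) k)
                ((osAdjoint P).appendTensor (translateMulti (EuclideanSpace.single 0 t) P)) -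
              T.schwinger n (k ∘ Fin.rev) (osAdjoint P) * T.schwinger n k P‖ ≤
            C * Real.exp (-Δ * t)) →
      T.HasMassGap Δ :=
  fun _ι _d _ hd T Δ hdiag => T.hasMassGap_of_diagBound hd Δ hdiag

/-- **The crux is EQUIVALENT to its diagonal core.**  `GapToContinuum` (for all `G, r, sch, T`,
`Δ > 0`: `IsYangMillsFor r sch T → HasLatticeMassGap r sch Δ → T.HasMassGap Δ`) holds iff the same
hypotheses give, for every arity `n ≥ 1`, species string `k` and single slab-ordered real product
tensor `P`, SOME constant `C` with the diagonal bound
`‖𝔖₂ₙ^{rev k ++ k}(ΘP* ⊗ T_t P) − 𝔖ₙ^{rev k}(ΘP*) 𝔖ₙ^{k}(P)‖ ≤ C e^{−Δt}` (`t ≥ 0`).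
`←` is stub L1 (`OSData.hasMassGap_of_diagBound`); `→` is the instance `F = G = P`,
`H = ΘP* ⊗ T_t P` of `T.HasMassGap Δ`.  So every proof or refutation of the crux may work with the
single-tensor, free-constant, diagonal statement. -/
theorem gapToContinuum_iff_diagonalCore :
    Summit.QuantumFields.YangMills.Theses.LangevinControlUV.GapToContinuum ↔
      ∀ (G : Type) [Group G] [TopologicalSpace G] [IsTopologicalGroup G] [CompactSpace G]
        [MeasurableSpace G] [BorelSpace G] (r : LatticeRep G) (sch : SpeciesScheme (YMSpecies G))
        (T : OSData (YMSpecies G) 4) (Δ : ℝ), 0 < Δ → IsYangMillsFor r sch T →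
          HasLatticeMassGap r sch Δ →
          ∀ (n : ℕ), n ≠ 0 → ∀ (k : Fin n → YMSpecies G)
            (P : 𝓢((Fin n → EuclideanSpace ℝ (Fin 4)), ℂ)),
            P ∈ slabOrderedProducts 4 n → ∃ C : ℝ, ∀ t : ℝ, 0 ≤ t →
              ‖T.schwinger (n + n) (Fin.append (k ∘ Fin.rev) k)
                    ((osAdjoint P).appendTensor (translateMulti (EuclideanSpace.single 0 t) P)) -
                  T.schwinger n (k ∘ Fin.rev) (osAdjoint P) * T.schwinger n k P‖ ≤
                C * Real.exp (-Δ * t) := by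
  constructor
  · intro h G _ _ _ _ _ _ r sch T Δ hΔ hYM hlat n _hn k P hP
    have hPt : IsTimeOrdered P := IsTimeOrdered.of_mem_slabOrderedProducts hP
    obtain ⟨C, hC⟩ := h G r sch T Δ hΔ hYM hlat n n k k P P hPt hPt
    exact ⟨C, fun t ht => (hC t ht _ (isAppendTensorOf_appendTensor _ _)).trans_eq (by ring)⟩
  · intro h G _ _ _ _ _ _ r sch T Δ hΔ hYM hlat
    exact stub_diagBoundToGap (YMSpecies G) 4 (by norm_num) T Δ (h G r sch T Δ hΔ hYM hlat)

end Summit.QuantumFields.YangMills.Theorems.GapToContinuum.SketchIdeator4
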